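import Literature.Analysis.FluidPDE.PassiveScalarDiagEnergyContinuity
import Literature.Analysis.FluidPDE.PassiveScalarDiagFourier
import HarnessLib

/-!
# The isotropic dissipation of weak solutions of the diagonal-diffusion passive scalar equation,
# in real form (`∫₀ᵗ ‖∇θ‖² dt` as a Bochner integral; injection ≤ datum + dissipation)

Analysis/FluidPDE proof file (everything proved; no definitions). The energy files of the diagonal
parabolic layer (`PassiveScalarDiagEnergy`, `…EnergyEquality`, `…EnergyContinuity`) measure the
dissipation of a weak solution `θ` of `∂ₜθ + u·∇θ = κ ∑ᵢ aᵢ ∂ᵢ∂ᵢθ + s`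
(`Torus.IsWeakScalarTransportDiagForcedOn T a κ u s θ₀ θ`) by the `A`-weighted quantity
`∫⁻_{(0,t)} ‖∇θ‖²_a` (`Torus.eScalarGradNormSqDiag a`, an `ℝ≥0∞` lower integral). Long-time
statements in the convention of the summit (`Literature.Turb.meanDissipation`,
`TurbWave0.timeMean g T = T⁻¹ ∫ t in 0..T, g t`) are phrased instead with the real function
`t ↦ κ (‖∇θ(t)‖²).toReal` of the ISOTROPIC spectral norm `Torus.eScalarGradNormSq` under a Bochner /
interval integral. This file is the dictionary between the two, for EVERY weak solution of the
class with `κ > 0`, `aᵢ > 0`, `θ₀ ∈ L²`, bounded drift, `L¹_t L²_x` source: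

* `aemeasurable_eScalarGradNormSqDiag_coeff`, `aemeasurable_eScalarGradNormSq` — the spectral
  gradient norms of the slices, for ANY nonnegative coefficient vector (in particular the isotropic
  one), are a.e.-measurable in time (countable suprema of finite sums of `|θ̂(τ)(k)|²`);
* `mul_lintegral_eScalarGradNormSq_le`, `lintegral_eScalarGradNormSqDiag_le_mul`,
  `lintegral_eScalarGradNormSq_lt_top` — `m ∫⁻‖∇θ‖² ≤ ∫⁻‖∇θ‖²_a ≤ M ∫⁻‖∇θ‖²` for `m ≤ aᵢ ≤ M`, so
  `θ ∈ L²_t H¹_x` in the isotropic sense too (Hess-Childs–Rowan 2025, App. A: non-isotropic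
  diffusions only change constants);
* `integrableOn_toReal_eScalarGradNormSq` — `τ ↦ (‖∇θ(τ)‖²).toReal ∈ L¹(0,T)` with
  `∫_{(0,t)} (‖∇θ‖²).toReal = (∫⁻_{(0,t)} ‖∇θ‖²).toReal`, and the interval-integral form
  `intervalIntegral_toReal_eScalarGradNormSq_eq`;
* `mul_integral_toReal_eScalarGradNormSq_le`, `integral_toReal_eScalarGradNormSqDiag_le_mul` — the
  two-sided comparison in real form;
* `ae_injection_le` — for a.e. `t`: `∫ θ₀² - ∫ θ(t)² + 2∫_{(0,t)} ∫ s θ ≤ 2κM ∫_{(0,t)} (‖∇θ‖²).toReal`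
  (`aᵢ ≤ M`; the energy equality at a.e. time, Bonicatto–Ciampa–Crippa 2024 Thm. 3.3 / (3.4), and
  the comparison); `two_mul_setIntegral_integral_mul_le` — **injection ≤ energy bound + dissipation
  at EVERY `t ∈ [0,T]`, for an arbitrary weak solution with `‖θ(t)‖² ≤ B` a.e. (no continuous
  representative needed)**: `2 ∫_{(0,t)} ∫ s θ ≤ B + 2κM ∫_{(0,t)} (‖∇θ‖²).toReal` (continuity in
  `t` of both primitives); with the interval-integral twin `two_mul_intervalIntegral_integral_mul_le`;
* `energy_eq_toReal_of_isL2ContinuousOn` — for the `L²`-continuous representative the energy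
  equality with the real `A`-dissipation integral, and `injection_le_of_isL2ContinuousOn`:
  `∫ θ₀² - ∫ θ(t)² + 2∫_{(0,t)}∫ s θ ≤ 2κM ∫_{(0,t)} (‖∇θ‖²).toReal`.

These are the forms in which "mean dissipation ≥ mean injection − boundary terms" is read off for
time averages (Doering–Foias 2002 §2 bookkeeping), uniformly over all weak solutions.

## Mathlib / tree search

`IsWeakScalarTransportDiagForcedOn.energy_eq` / `energy_eq_of_isL2ContinuousOn` /
`lintegral_eScalarGradNormSqDiag_lt_top` / `integrableOn_toReal_eScalarGradNormSqDiag` /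
`aemeasurable_eScalarGradNormSqDiag` (coefficients of the equation only) / `integrableOn_mFourierCoeff`;
`Torus.mul_eScalarGradNormSq_le_diag`, `eScalarGradNormSqDiag_le_mul`, `eScalarGradNormSqDiag_one`,
`iSup_sum_freqBall_diag`, `sum_freqBall_diag_eq_ofReal`. Mathlib: `integral_toReal`,
`integrable_toReal_of_lintegral_ne_top`, `intervalIntegral.continuousOn_primitive_interval'`,
`Measure.eqOn_Icc_of_ae_eq`.

## References

* P. Bonicatto, G. Ciampa, G. Crippa, J. Math. Pures Appl. (2024), Thm. 3.3, (3.4), Remark 3.4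
  (energy balance of distributional solutions with bounded divergence-free drift).
  [`BonicattoCiampaCrippa2023`]
* E. Hess-Childs, K. Rowan, arXiv:2501.18526 (2025), App. A (non-isotropic diffusions, modified
  constants). [`HessChildsRowan2025a`]
* C. R. Doering, C. Foias, J. Fluid Mech. 467 (2002), §2 (time averages of the energy balance).
  [`DoeringFoias2002`]
-/

noncomputable section

open MeasureTheory Set Filter UnitAddTorus
open _root_.Topology
open scoped ENNReal NNReal

namespace Literature.Analysis.FluidPDE

namespace Torus

open Literature.Analysis.FunctionSpaces.Torus Literature.Analysis.FunctionSpaces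

variable {d : Type*} [Fintype d] [DecidableEq d]

namespace IsWeakScalarTransportDiagForcedOn

variable {T κ : ℝ} {a : d → ℝ} {u : ℝ → UnitAddTorus d → EuclideanSpace ℝ d}
  {s : ℝ → UnitAddTorus d → ℝ} {θ₀ : UnitAddTorus d → ℝ} {θ : ℝ → UnitAddTorus d → ℝ}

/-! ## 1. Measurability in time of the spectral gradient norms of the slices -/

/-- The spectral `B`-weighted gradient norm `τ ↦ ‖∇θ(τ)‖²_b` of a weak solution is a.e.-measurable
on `(0,T)` for ANY nonnegative coefficient vector `b` (not only the equation's): it is the supremum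
over the frequency balls of finite sums of `Q_b(k) |θ̂(τ)(k)|²`, and each `τ ↦ θ̂(τ)(k)` is
integrable on `(0,T)`. [cite: Grafakos2014, Prop. 3.2.7 (3)] -/
theorem aemeasurable_eScalarGradNormSqDiag_coeff (h : IsWeakScalarTransportDiagForcedOn T a κ u s θ₀ θ)
    {b : d → ℝ} (hb : ∀ i, 0 ≤ b i) :
    AEMeasurable (fun τ => Torus.eScalarGradNormSqDiag b (θ τ)) (volume.restrict (Ioo 0 T)) := by
  have e : (fun τ => Torus.eScalarGradNormSqDiag b (θ τ)) = fun τ => ⨆ N : ℕ,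
      ENNReal.ofReal (4 * Real.pi ^ 2 * ∑ k ∈ freqBall N,
        Torus.diagSymbol b k * ‖mFourierCoeff (fun x => (θ τ x : ℂ)) k‖ ^ 2) := by
    funext τ
    rw [← Torus.iSup_sum_freqBall_diag b (θ τ)]
    exact iSup_congr fun N => Torus.sum_freqBall_diag_eq_ofReal hb (θ τ) N
  rw [e]
  have hk : ∀ k : d → ℤ, AEMeasurable (fun τ => ‖mFourierCoeff (fun x => (θ τ x : ℂ)) k‖ ^ 2)
      (volume.restrict (Ioo 0 T)) := fun k =>
    (h.integrableOn_mFourierCoeff k).aestronglyMeasurable.norm.aemeasurable.pow_const 2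
  refine AEMeasurable.iSup fun N => ?_
  have hsum : AEMeasurable (fun τ => ∑ k ∈ freqBall N,
      Torus.diagSymbol b k * ‖mFourierCoeff (fun x => (θ τ x : ℂ)) k‖ ^ 2) (volume.restrict (Ioo 0 T)) :=
    Finset.aemeasurable_fun_sum (freqBall N) fun k _ => (hk k).const_mul (Torus.diagSymbol b k)
  exact (hsum.const_mul (4 * Real.pi ^ 2)).ennreal_ofReal

/-- The ISOTROPIC spectral gradient norm `τ ↦ ‖∇θ(τ)‖²` of a weak solution of the diagonal class
is a.e.-measurable on `(0,T)`. [cite: Grafakos2014, Prop. 3.2.7 (3)] -/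
theorem aemeasurable_eScalarGradNormSq (h : IsWeakScalarTransportDiagForcedOn T a κ u s θ₀ θ) :
    AEMeasurable (fun τ => Torus.eScalarGradNormSq (θ τ)) (volume.restrict (Ioo 0 T)) := by
  have := h.aemeasurable_eScalarGradNormSqDiag_coeff (b := fun _ : d => (1 : ℝ)) fun _ => zero_le_one
  simpa only [Torus.eScalarGradNormSqDiag_one] using this

/-! ## 2. `m ∫⁻‖∇θ‖² ≤ ∫⁻‖∇θ‖²_a ≤ M ∫⁻‖∇θ‖²`; the isotropic `L²_t H¹_x` bound -/

omit [DecidableEq d] in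
/-- Lower comparison of the time-integrated dissipations on any set of times:
`m ∫⁻_S ‖∇θ‖² ≤ ∫⁻_S ‖∇θ‖²_a` for `0 ≤ m ≤ aᵢ`. [cite: HessChildsRowan2025a, App. A (non-isotropic diffusions, modified constants)] -/
theorem mul_lintegral_eScalarGradNormSq_le (θ : ℝ → UnitAddTorus d → ℝ) {m : ℝ} (hm : 0 ≤ m)
    (hma : ∀ i, m ≤ a i) (S : Set ℝ) :
    ENNReal.ofReal m * ∫⁻ τ in S, Torus.eScalarGradNormSq (θ τ) ≤
      ∫⁻ τ in S, Torus.eScalarGradNormSqDiag a (θ τ) := by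
  rw [← lintegral_const_mul' _ _ ENNReal.ofReal_ne_top]
  exact lintegral_mono fun τ => Torus.mul_eScalarGradNormSq_le_diag hm hma (θ τ)

omit [DecidableEq d] in
/-- Upper comparison of the time-integrated dissipations on any set of times:
`∫⁻_S ‖∇θ‖²_a ≤ M ∫⁻_S ‖∇θ‖²` for `aᵢ ≤ M`, `0 ≤ M`. [cite: HessChildsRowan2025a, App. A (non-isotropic diffusions, modified constants)] -/
theorem lintegral_eScalarGradNormSqDiag_le_mul (θ : ℝ → UnitAddTorus d → ℝ) {M : ℝ} (hM0 : 0 ≤ M)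
    (hM : ∀ i, a i ≤ M) (S : Set ℝ) :
    ∫⁻ τ in S, Torus.eScalarGradNormSqDiag a (θ τ) ≤
      ENNReal.ofReal M * ∫⁻ τ in S, Torus.eScalarGradNormSq (θ τ) := by
  rw [← lintegral_const_mul' _ _ ENNReal.ofReal_ne_top]
  exact lintegral_mono fun τ => Torus.eScalarGradNormSqDiag_le_mul hM0 hM (θ τ)

omit [DecidableEq d] in
/-- Positive coefficients on a finite index type have a positive lower bound. [folklore] -/
private theorem exists_pos_le_of_forall_pos (ha : ∀ i, 0 < a i) : ∃ m : ℝ, 0 < m ∧ ∀ i, m ≤ a i := by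
  classical
  rcases isEmpty_or_nonempty d with hd | hd
  · exact ⟨1, one_pos, fun i => (IsEmpty.false i).elim⟩
  · obtain ⟨i₀, -, hi₀⟩ := Finset.exists_min_image Finset.univ a Finset.univ_nonempty
    exact ⟨a i₀, ha i₀, fun i => hi₀ i (Finset.mem_univ _)⟩

/-- **Parabolic regularity in the isotropic norm**: for `κ > 0`, `aᵢ > 0`, `θ₀ ∈ L²`, a bounded
drift and an `L¹_t L²_x` source, every weak solution of the diagonal class has
`∫⁻_{(0,T)} ‖∇θ‖² < ∞` (`θ ∈ L²_t H¹_x`; from the `A`-norm statement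
`lintegral_eScalarGradNormSqDiag_lt_top` and `min aᵢ ‖∇θ‖² ≤ ‖∇θ‖²_a`).
[cite: BonicattoCiampaCrippa2023, Thm. 3.3] -/
theorem lintegral_eScalarGradNormSq_lt_top (h : IsWeakScalarTransportDiagForcedOn T a κ u s θ₀ θ)
    (hκ : 0 < κ) (ha : ∀ i, 0 < a i) (hθ₀ : MemLp θ₀ 2 volume)
    (hu : MemLp (stLift u) ⊤ (volume.restrict (Ioo 0 T ×ˢ univ)))
    (hs : ∫⁻ t in Ioo 0 T, (∫⁻ x, ‖s t x‖ₑ ^ 2) ^ (1 / 2 : ℝ) < ⊤) :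
    ∫⁻ τ in Ioo 0 T, Torus.eScalarGradNormSq (θ τ) < ⊤ := by
  obtain ⟨m, hm, hma⟩ := exists_pos_le_of_forall_pos ha
  have hfin := h.lintegral_eScalarGradNormSqDiag_lt_top hκ ha hθ₀ hu hs
  have hle := (mul_lintegral_eScalarGradNormSq_le θ hm.le hma (Ioo 0 T)).trans_lt hfin
  have hm0 : ENNReal.ofReal m ≠ 0 := by rwa [Ne, ENNReal.ofReal_eq_zero, not_le]
  by_contra htop
  rw [not_lt, top_le_iff] at htop
  rw [htop, ENNReal.mul_top hm0] at hle
  exact lt_irrefl _ hle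

/-! ## 3. The real form `∫ (‖∇θ‖²).toReal` -/

/-- **The isotropic dissipation in real form**: `τ ↦ (‖∇θ(τ)‖²).toReal` is integrable on `(0,T)`
and `∫_{(0,t)} (‖∇θ‖²).toReal = (∫⁻_{(0,t)} ‖∇θ‖²).toReal` for `t ≤ T` (the `A`-norm twin is
`integrableOn_toReal_eScalarGradNormSqDiag`). [cite: BonicattoCiampaCrippa2023, Thm. 3.3] -/
theorem integrableOn_toReal_eScalarGradNormSq (h : IsWeakScalarTransportDiagForcedOn T a κ u s θ₀ θ)
    (hκ : 0 < κ) (ha : ∀ i, 0 < a i) (hθ₀ : MemLp θ₀ 2 volume)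
    (hu : MemLp (stLift u) ⊤ (volume.restrict (Ioo 0 T ×ˢ univ)))
    (hs : ∫⁻ t in Ioo 0 T, (∫⁻ x, ‖s t x‖ₑ ^ 2) ^ (1 / 2 : ℝ) < ⊤) :
    IntegrableOn (fun τ => (Torus.eScalarGradNormSq (θ τ)).toReal) (Ioo 0 T) volume ∧
      ∀ t, t ≤ T → ∫ τ in Ioo 0 t, (Torus.eScalarGradNormSq (θ τ)).toReal =
        (∫⁻ τ in Ioo 0 t, Torus.eScalarGradNormSq (θ τ)).toReal := by
  have hm := h.aemeasurable_eScalarGradNormSq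
  have hfin := h.lintegral_eScalarGradNormSq_lt_top hκ ha hθ₀ hu hs
  refine ⟨integrable_toReal_of_lintegral_ne_top hm hfin.ne, fun t ht => ?_⟩
  have hsub : Ioo 0 t ⊆ Ioo 0 T := Ioo_subset_Ioo_right ht
  have hm' : AEMeasurable (fun τ => Torus.eScalarGradNormSq (θ τ)) (volume.restrict (Ioo 0 t)) :=
    hm.mono_measure (Measure.restrict_mono hsub le_rfl)
  refine integral_toReal hm' (ae_lt_top' hm' ?_)
  exact ((lintegral_mono_set hsub).trans_lt hfin).ne

/-- The interval-integral form (the one inside `timeMean`): for `0 ≤ t ≤ T`,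
`∫ τ in 0..t, (‖∇θ(τ)‖²).toReal = (∫⁻_{(0,t)} ‖∇θ‖²).toReal`. [cite: BonicattoCiampaCrippa2023, Thm. 3.3] -/
theorem intervalIntegral_toReal_eScalarGradNormSq_eq (h : IsWeakScalarTransportDiagForcedOn T a κ u s θ₀ θ)
    (hκ : 0 < κ) (ha : ∀ i, 0 < a i) (hθ₀ : MemLp θ₀ 2 volume)
    (hu : MemLp (stLift u) ⊤ (volume.restrict (Ioo 0 T ×ˢ univ)))
    (hs : ∫⁻ t in Ioo 0 T, (∫⁻ x, ‖s t x‖ₑ ^ 2) ^ (1 / 2 : ℝ) < ⊤) {t : ℝ} (ht0 : 0 ≤ t) (ht : t ≤ T) :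
    ∫ τ in (0:ℝ)..t, (Torus.eScalarGradNormSq (θ τ)).toReal =
      (∫⁻ τ in Ioo 0 t, Torus.eScalarGradNormSq (θ τ)).toReal := by
  rw [intervalIntegral.integral_of_le ht0, integral_Ioc_eq_integral_Ioo]
  exact (h.integrableOn_toReal_eScalarGradNormSq hκ ha hθ₀ hu hs).2 t ht

/-- **Lower comparison in real form**: `m ∫_{(0,t)} (‖∇θ‖²).toReal ≤ ∫_{(0,t)} (‖∇θ‖²_a).toReal` for
`0 ≤ m ≤ aᵢ`, `t ≤ T`. [cite: HessChildsRowan2025a, App. A (non-isotropic diffusions, modified constants)] -/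
theorem mul_integral_toReal_eScalarGradNormSq_le (h : IsWeakScalarTransportDiagForcedOn T a κ u s θ₀ θ)
    (hκ : 0 < κ) (ha : ∀ i, 0 < a i) (hθ₀ : MemLp θ₀ 2 volume)
    (hu : MemLp (stLift u) ⊤ (volume.restrict (Ioo 0 T ×ˢ univ)))
    (hs : ∫⁻ t in Ioo 0 T, (∫⁻ x, ‖s t x‖ₑ ^ 2) ^ (1 / 2 : ℝ) < ⊤)
    {m : ℝ} (hm : 0 ≤ m) (hma : ∀ i, m ≤ a i) {t : ℝ} (ht : t ≤ T) :
    m * ∫ τ in Ioo 0 t, (Torus.eScalarGradNormSq (θ τ)).toReal ≤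
      ∫ τ in Ioo 0 t, (Torus.eScalarGradNormSqDiag a (θ τ)).toReal := by
  rw [(h.integrableOn_toReal_eScalarGradNormSq hκ ha hθ₀ hu hs).2 t ht,
    (h.integrableOn_toReal_eScalarGradNormSqDiag hκ ha hθ₀ hu hs).2 t ht]
  have hsub : Ioo 0 t ⊆ Ioo 0 T := Ioo_subset_Ioo_right ht
  have hfinD : ∫⁻ τ in Ioo 0 t, Torus.eScalarGradNormSqDiag a (θ τ) ≠ ⊤ :=
    ((lintegral_mono_set hsub).trans_lt (h.lintegral_eScalarGradNormSqDiag_lt_top hκ ha hθ₀ hu hs)).ne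
  have hle := mul_lintegral_eScalarGradNormSq_le θ hm hma (Ioo 0 t)
  rw [← ENNReal.toReal_ofReal hm, ← ENNReal.toReal_mul]
  exact ENNReal.toReal_mono hfinD hle

/-- **Upper comparison in real form**: `∫_{(0,t)} (‖∇θ‖²_a).toReal ≤ M ∫_{(0,t)} (‖∇θ‖²).toReal` for
`aᵢ ≤ M`, `0 ≤ M`, `t ≤ T`. [cite: HessChildsRowan2025a, App. A (non-isotropic diffusions, modified constants)] -/
theorem integral_toReal_eScalarGradNormSqDiag_le_mul (h : IsWeakScalarTransportDiagForcedOn T a κ u s θ₀ θ)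
    (hκ : 0 < κ) (ha : ∀ i, 0 < a i) (hθ₀ : MemLp θ₀ 2 volume)
    (hu : MemLp (stLift u) ⊤ (volume.restrict (Ioo 0 T ×ˢ univ)))
    (hs : ∫⁻ t in Ioo 0 T, (∫⁻ x, ‖s t x‖ₑ ^ 2) ^ (1 / 2 : ℝ) < ⊤)
    {M : ℝ} (hM0 : 0 ≤ M) (hM : ∀ i, a i ≤ M) {t : ℝ} (ht : t ≤ T) :
    ∫ τ in Ioo 0 t, (Torus.eScalarGradNormSqDiag a (θ τ)).toReal ≤
      M * ∫ τ in Ioo 0 t, (Torus.eScalarGradNormSq (θ τ)).toReal := by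
  rw [(h.integrableOn_toReal_eScalarGradNormSq hκ ha hθ₀ hu hs).2 t ht,
    (h.integrableOn_toReal_eScalarGradNormSqDiag hκ ha hθ₀ hu hs).2 t ht]
  have hsub : Ioo 0 t ⊆ Ioo 0 T := Ioo_subset_Ioo_right ht
  have hfinI : ∫⁻ τ in Ioo 0 t, Torus.eScalarGradNormSq (θ τ) ≠ ⊤ :=
    ((lintegral_mono_set hsub).trans_lt (h.lintegral_eScalarGradNormSq_lt_top hκ ha hθ₀ hu hs)).ne
  have hle := lintegral_eScalarGradNormSqDiag_le_mul θ hM0 hM (Ioo 0 t)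
  rw [← ENNReal.toReal_ofReal hM0, ← ENNReal.toReal_mul]
  exact ENNReal.toReal_mono (ENNReal.mul_ne_top ENNReal.ofReal_ne_top hfinI) hle

/-! ## 4. Injection ≤ datum + dissipation -/

omit [Fintype d] [DecidableEq d] in
/-- An inequality `F ≤ G` holding a.e. on `(0,T)` between functions continuous on `[0,T]` holds at
every point of `[0,T]`. [folklore] -/
private theorem le_of_ae_Ioo_le_of_continuousOn' {F G : ℝ → ℝ} {T : ℝ} (hT : 0 < T)
    (hF : ContinuousOn F (Icc 0 T)) (hG : ContinuousOn G (Icc 0 T))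
    (h : ∀ᵐ t ∂((volume : Measure ℝ).restrict (Ioo 0 T)), F t ≤ G t) : ∀ t ∈ Icc 0 T, F t ≤ G t := by
  have h' : ∀ᵐ t ∂((volume : Measure ℝ).restrict (Icc 0 T)), F t ≤ G t := by
    rw [← Measure.restrict_congr_set Ioo_ae_eq_Icc]
    exact h
  have hc : ContinuousOn (fun t => max (F t - G t) 0) (Icc 0 T) :=
    (continuous_id.max continuous_const).comp_continuousOn (hF.sub hG)
  have hae : (fun t => max (F t - G t) 0) =ᵐ[volume.restrict (Icc 0 T)] fun _ => (0 : ℝ) := by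
    filter_upwards [h'] with t ht
    exact max_eq_right (by linarith)
  have heq := Measure.eqOn_Icc_of_ae_eq (μ := volume) hT.ne hae hc continuousOn_const
  intro t ht
  have h1 := heq ht
  simp only at h1
  have h2 : F t - G t ≤ max (F t - G t) 0 := le_max_left _ _
  rw [h1] at h2
  linarith

omit [Fintype d] [DecidableEq d] in
/-- The primitive `t ↦ ∫_{(0,t)} f` of a function integrable on `(0,T)` is continuous on `[0,T]`. [folklore] -/
private theorem continuousOn_setIntegral_Ioo {f : ℝ → ℝ} {T : ℝ} (hf : IntegrableOn f (Ioo 0 T) volume) :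
    ContinuousOn (fun t => ∫ τ in Ioo 0 t, f τ) (Icc 0 T) := by
  rcases lt_or_ge T 0 with hT | hT
  · rw [Icc_eq_empty_of_lt hT]
    exact continuousOn_empty _
  have hfi : IntervalIntegrable f volume 0 T :=
    (intervalIntegrable_iff_integrableOn_Ioc_of_le hT).2 (hf.congr_set_ae Ioo_ae_eq_Ioc.symm)
  have hc := intervalIntegral.continuousOn_primitive_interval' hfi left_mem_uIcc
  rw [uIcc_of_le hT] at hc
  refine hc.congr fun t ht => ?_
  dsimp only
  rw [intervalIntegral.integral_of_le ht.1, integral_Ioc_eq_integral_Ioo]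

/-- **Injection ≤ energy + dissipation, a.e. in time, for an arbitrary weak solution**: for
`κ > 0`, `0 < aᵢ ≤ M`, `θ₀ ∈ L²`, a bounded drift and an `L¹_t L²_x` source, every weak solution of
the diagonal class satisfies, for a.e. `t ∈ (0,T)`,
`∫ θ₀² - ∫ θ(t)² + 2 ∫_{(0,t)} ∫ s θ = 2κ ∫_{(0,t)} (‖∇θ‖²_a).toReal ≤ 2κM ∫_{(0,t)} (‖∇θ(τ)‖²).toReal dτ`
(the energy equality at a.e. time and `‖∇θ‖²_a ≤ M‖∇θ‖²`).
[cite: BonicattoCiampaCrippa2023, Thm. 3.3, (3.4) and Remark 3.4] -/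
theorem ae_injection_le (h : IsWeakScalarTransportDiagForcedOn T a κ u s θ₀ θ)
    (hκ : 0 < κ) (ha : ∀ i, 0 < a i) (hθ₀ : MemLp θ₀ 2 volume)
    (hu : MemLp (stLift u) ⊤ (volume.restrict (Ioo 0 T ×ˢ univ)))
    (hs : ∫⁻ t in Ioo 0 T, (∫⁻ x, ‖s t x‖ₑ ^ 2) ^ (1 / 2 : ℝ) < ⊤)
    {M : ℝ} (hM0 : 0 ≤ M) (hM : ∀ i, a i ≤ M) :
    ∀ᵐ t ∂(volume.restrict (Ioo 0 T)),
      (∫ x, θ₀ x ^ 2) - (∫ x, θ t x ^ 2) + 2 * ∫ τ in Ioo 0 t, ∫ x, s τ x * θ τ x ≤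
        2 * (κ * M) * ∫ τ in Ioo 0 t, (Torus.eScalarGradNormSq (θ τ)).toReal := by
  filter_upwards [h.energy_eq hκ ha hθ₀ hu hs, ae_restrict_mem measurableSet_Ioo] with t ht htI
  have hcmp := h.integral_toReal_eScalarGradNormSqDiag_le_mul hκ ha hθ₀ hu hs hM0 hM htI.2.le
  rw [← (h.integrableOn_toReal_eScalarGradNormSqDiag hκ ha hθ₀ hu hs).2 t htI.2.le] at ht
  nlinarith [hκ.le]

/-- **Injection ≤ energy bound + dissipation, at EVERY time, for an arbitrary weak solution.** If
moreover `‖θ(t)‖²_{L²} ≤ B` for a.e. `t ∈ (0,T)` (`T > 0`), then for EVERY `t ∈ [0,T]`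
`2 ∫_{(0,t)} ∫ s θ ≤ B + 2κM ∫_{(0,t)} (‖∇θ(τ)‖²).toReal dτ`
— the work of the source up to time `t` is at most the energy bound plus (`M` times) the isotropic
dissipation; both primitives are continuous in `t`, so the a.e. statement upgrades to every time
and NO continuous representative is needed. Divided by `t`, this is "mean dissipation ≥ mean
injection − B/(2t)" (Doering–Foias 2002 §2 bookkeeping).
[cite: BonicattoCiampaCrippa2023, Thm. 3.3, (3.4) and Remark 3.4] -/
theorem two_mul_setIntegral_integral_mul_le (h : IsWeakScalarTransportDiagForcedOn T a κ u s θ₀ θ)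
    (hT : 0 < T) (hκ : 0 < κ) (ha : ∀ i, 0 < a i) (hθ₀ : MemLp θ₀ 2 volume)
    (hu : MemLp (stLift u) ⊤ (volume.restrict (Ioo 0 T ×ˢ univ)))
    (hs : ∫⁻ t in Ioo 0 T, (∫⁻ x, ‖s t x‖ₑ ^ 2) ^ (1 / 2 : ℝ) < ⊤)
    {M : ℝ} (hM0 : 0 ≤ M) (hM : ∀ i, a i ≤ M)
    {B : ℝ} (hB : ∀ᵐ t ∂(volume.restrict (Ioo 0 T)), ∫ x, θ t x ^ 2 ≤ B) :
    ∀ t ∈ Icc 0 T, 2 * ∫ τ in Ioo 0 t, ∫ x, s τ x * θ τ x ≤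
      B + 2 * (κ * M) * ∫ τ in Ioo 0 t, (Torus.eScalarGradNormSq (θ τ)).toReal := by
  have hI := (h.integrableOn_toReal_eScalarGradNormSq hκ ha hθ₀ hu hs).1
  have hsI := h.integrableOn_integral_source_mul hs
  have hae : ∀ᵐ t ∂(volume.restrict (Ioo 0 T)), 2 * ∫ τ in Ioo 0 t, ∫ x, s τ x * θ τ x ≤
      B + 2 * (κ * M) * ∫ τ in Ioo 0 t, (Torus.eScalarGradNormSq (θ τ)).toReal := by
    filter_upwards [h.ae_injection_le hκ ha hθ₀ hu hs hM0 hM, hB] with t ht htB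
    have h0 : 0 ≤ ∫ x, θ₀ x ^ 2 := integral_nonneg fun x => sq_nonneg _
    linarith
  have hF : ContinuousOn (fun t => 2 * ∫ τ in Ioo 0 t, ∫ x, s τ x * θ τ x) (Icc 0 T) :=
    continuousOn_const.mul (continuousOn_setIntegral_Ioo hsI)
  have hG : ContinuousOn (fun t => B + 2 * (κ * M) * ∫ τ in Ioo 0 t, (Torus.eScalarGradNormSq (θ τ)).toReal)
      (Icc 0 T) :=
    continuousOn_const.add (continuousOn_const.mul (continuousOn_setIntegral_Ioo hI))
  exact le_of_ae_Ioo_le_of_continuousOn' hT hF hG hae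

/-- The interval-integral twin (the form inside `timeMean`): for every `t ∈ [0,T]`,
`2 ∫ τ in 0..t, ∫ s θ ≤ B + 2κM ∫ τ in 0..t, (‖∇θ(τ)‖²).toReal`. [cite: BonicattoCiampaCrippa2023, Thm. 3.3, (3.4) and Remark 3.4] -/
theorem two_mul_intervalIntegral_integral_mul_le (h : IsWeakScalarTransportDiagForcedOn T a κ u s θ₀ θ)
    (hT : 0 < T) (hκ : 0 < κ) (ha : ∀ i, 0 < a i) (hθ₀ : MemLp θ₀ 2 volume)
    (hu : MemLp (stLift u) ⊤ (volume.restrict (Ioo 0 T ×ˢ univ)))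
    (hs : ∫⁻ t in Ioo 0 T, (∫⁻ x, ‖s t x‖ₑ ^ 2) ^ (1 / 2 : ℝ) < ⊤)
    {M : ℝ} (hM0 : 0 ≤ M) (hM : ∀ i, a i ≤ M)
    {B : ℝ} (hB : ∀ᵐ t ∂(volume.restrict (Ioo 0 T)), ∫ x, θ t x ^ 2 ≤ B) :
    ∀ t ∈ Icc 0 T, 2 * ∫ τ in (0:ℝ)..t, ∫ x, s τ x * θ τ x ≤
      B + 2 * (κ * M) * ∫ τ in (0:ℝ)..t, (Torus.eScalarGradNormSq (θ τ)).toReal := by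
  intro t ht
  rw [intervalIntegral.integral_of_le ht.1, intervalIntegral.integral_of_le ht.1,
    integral_Ioc_eq_integral_Ioo, integral_Ioc_eq_integral_Ioo]
  exact h.two_mul_setIntegral_integral_mul_le hT hκ ha hθ₀ hu hs hM0 hM hB t ht

/-- **Energy equality with the real `A`-dissipation integral, `L²`-continuous representative**:
for every `t ∈ [0,T]`, `∫ θ(t)² + 2κ ∫_{(0,t)} (‖∇θ‖²_a).toReal = ∫ θ₀² + 2 ∫_{(0,t)} ∫ s θ`.
[cite: BonicattoCiampaCrippa2023, Thm. 3.3, (3.4) and Remark 3.4] -/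
theorem energy_eq_toReal_of_isL2ContinuousOn (h : IsWeakScalarTransportDiagForcedOn T a κ u s θ₀ θ)
    (hT : 0 < T) (hκ : 0 < κ) (ha : ∀ i, 0 < a i) (hθ₀ : MemLp θ₀ 2 volume)
    (hu : MemLp (stLift u) ⊤ (volume.restrict (Ioo 0 T ×ˢ univ)))
    (hs : ∫⁻ t in Ioo 0 T, (∫⁻ x, ‖s t x‖ₑ ^ 2) ^ (1 / 2 : ℝ) < ⊤) (hc : IsL2ContinuousOn (Icc 0 T) θ) :
    ∀ t ∈ Icc 0 T, (∫ x, θ t x ^ 2) + 2 * κ * ∫ τ in Ioo 0 t, (Torus.eScalarGradNormSqDiag a (θ τ)).toReal =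
      (∫ x, θ₀ x ^ 2) + 2 * ∫ τ in Ioo 0 t, ∫ x, s τ x * θ τ x := by
  intro t ht
  rw [(h.integrableOn_toReal_eScalarGradNormSqDiag hκ ha hθ₀ hu hs).2 t ht.2]
  exact h.energy_eq_of_isL2ContinuousOn hT hκ ha hθ₀ hu hs hc t ht

/-- **Injection minus energy gain ≤ dissipation, `L²`-continuous representative**: for every
`t ∈ [0,T]` and `aᵢ ≤ M`,
`∫ θ₀² - ∫ θ(t)² + 2 ∫_{(0,t)} ∫ s θ = 2κ ∫_{(0,t)} (‖∇θ‖²_a).toReal ≤ 2κM ∫_{(0,t)} (‖∇θ‖²).toReal`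
(the form "mean dissipation ≥ mean injection − boundary term / T" is read from).
[cite: BonicattoCiampaCrippa2023, Thm. 3.3, (3.4) and Remark 3.4] -/
theorem injection_le_of_isL2ContinuousOn (h : IsWeakScalarTransportDiagForcedOn T a κ u s θ₀ θ)
    (hT : 0 < T) (hκ : 0 < κ) (ha : ∀ i, 0 < a i) (hθ₀ : MemLp θ₀ 2 volume)
    (hu : MemLp (stLift u) ⊤ (volume.restrict (Ioo 0 T ×ˢ univ)))
    (hs : ∫⁻ t in Ioo 0 T, (∫⁻ x, ‖s t x‖ₑ ^ 2) ^ (1 / 2 : ℝ) < ⊤) (hc : IsL2ContinuousOn (Icc 0 T) θ)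
    {M : ℝ} (hM0 : 0 ≤ M) (hM : ∀ i, a i ≤ M) :
    ∀ t ∈ Icc 0 T, (∫ x, θ₀ x ^ 2) - (∫ x, θ t x ^ 2) + 2 * ∫ τ in Ioo 0 t, ∫ x, s τ x * θ τ x ≤
      2 * (κ * M) * ∫ τ in Ioo 0 t, (Torus.eScalarGradNormSq (θ τ)).toReal := by
  intro t ht
  have hE := h.energy_eq_toReal_of_isL2ContinuousOn hT hκ ha hθ₀ hu hs hc t ht
  have hcmp := h.integral_toReal_eScalarGradNormSqDiag_le_mul hκ ha hθ₀ hu hs hM0 hM ht.2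
  nlinarith [hκ.le]

end IsWeakScalarTransportDiagForcedOn

end Torus

end Literature.Analysis.FluidPDE

end
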